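import Literature.NumberTheory.EllipticCurves.ZpCorankCyclotomicPrimePow
import HarnessLib

/-!
# `ℤ_p`-coranks under a dihedral group `D_{2p}` of automorphisms: `rk(F) = rk(M) + (p-1) m_ρ` and `rk(L) = rk(K) + (p-1)/2 · m_ρ`

Pure algebra behind the `D_{2p}`-decomposition used in T. Dokchitser, V. Dokchitser, *On the
Birch–Swinnerton-Dyer quotients modulo squares*, Ann. of Math. 172 (2010), 567–596, §4.5
(Prop. 4.17, for `Gal(F/K) = D_{2p}`, `M/K` and `L/K` of degree `2` and `p`: the quantity
`2/(p-1) · (rk_p(A/L) - rk_p(A/K))`) and §4.6, proof of Thm. 4.19 (p. 26): "`H = Gal(F/K) ≅ D_{2p}`.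
As every `ℚ_p[H]`-module, [`X = X_p(E/F)`] decomposes as `X ≅ 1^{⊕m_1} ⊕ ε^{⊕m_ε} ⊕ ρ^{⊕m_ρ}`,
where `1` stands for the trivial representation, `ε` is the sign and `ρ` the `(p-1)`-dimensional
irreducible representation of `H`. As `X_p(E/K) = X^H` etc. (Lemma 4.14), `rk_p(E/K) = m_1`,
`rk_p(E/M) = m_1 + m_ε`, `rk_p(E/L) = m_1 + (p-1)/2 · m_ρ`" — together with
`rk_p(E/F) = dim X = m_1 + m_ε + (p-1) m_ρ`. So the `m_ρ` of §4.6 (and of the transcription of the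
dihedral congruence in `BSDSelmerParityDokchitserHeegnerFieldProofs`,
`rk_p(E/F) = rk_p(E/M) + (p-1) m_ρ`) is the same number as Prop. 4.17's
`2/(p-1) · (rk_p(E/L) - rk_p(E/K))`.

On the tree's model of `ℤ_p`-coranks of discrete `p`-primary groups with finite `p`-torsion
(`zpCorank`, files `Selmer`, `ZpCorankQuasiIso`; the Pontryagin-dual side of `X`), for
endomorphisms `σ`, `τ` of `A` with `σ^p = 1`, `τ² = 1`, `σ τ σ = τ` (`p` an odd prime) — the
images of a rotation and a reflection of `D_{2p}` — this file proves, with `A^σ = fixedSub σ`,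
`A^τ = fixedSub τ`, `A^H = fixedSub σ ⊓ fixedSub τ`:

* `exists_zpCorank_eq_and_zpCorank_fixedSub_eq_of_dihedral` — **there is a natural number
  `k` (`= m_ρ`) with `corank A = corank A^σ + (p - 1)·k` and `corank A^τ = corank A^H + (p-1)/2 · k`.**

The proof is representation-theory-free: `A ≈ A^σ × B` with `B = ker N_σ`
(`ZpCorankCyclotomicDivisibility`, `ZpCorankCyclotomicPrimePow`), compatibly with `τ`, so
`A^τ ≈ (A^σ)^τ × B^τ` (`zpCorank_fixedSub_eq_add_of_dihedral`); on `B`, where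
`1 + σ + ⋯ + σ^(p-1) = 0` and `corank B = (p-1)·k`, the element `θ = σ - σ⁻¹` anticommutes with
`τ`, has kernel killed by `p` and image containing `2p·B` (`1 + σ` is invertible up to `2`,
`σ - 1` up to `p`), hence swaps the `±1`-eigenspaces of `τ` up to quasi-isomorphism
(`zpCorank_fixedSub_eq_zpCorank_fixedSub_neg`), while `B ≈ B^τ × B^{-τ}` (`2` is harmless for
`p` odd; `zpCorank_eq_zpCorank_fixedSub_add_zpCorank_fixedSub_neg`); so `corank B^τ = (p-1)k/2`.
(Over `ℚ_p`: `B ⊗ ℚ_p` is a `ℚ_p(ζ_p)`-vector space of dimension `k` with a semilinear involution,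
and Galois descent to `ℚ_p(ζ_p)⁺`.)

Everything here is proved; no named fact is introduced; there is no number theory in this file.
Its use: `A = Sel_{p^∞}(E/F)` for `Gal(F/K) ≅ D_{2p}` with Lemma 4.14 identifying `A^σ`, `A^τ`,
`A^H` with the Selmer groups over `M = F^σ`, `L = F^τ`, `K` up to quasi-isomorphism.

## References

* [DokchitserDokchitserAnnals2010] T. Dokchitser, V. Dokchitser, Ann. of Math. 172 (2010),
  567–596 = arXiv:math/0610290, §4.5 Prop. 4.17 (arXiv Prop. 50) and §4.6, proof of Thm. 4.19
  (p. 26).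
* [Greenberg1999] R. Greenberg, *Iwasawa theory for elliptic curves*, LNM 1716 (1999), §1.
-/

noncomputable section

open Function Polynomial
open scoped AddSubgroup

namespace Literature.NumberTheory.EllipticCurves

/-! ## Dihedral relations in a monoid of endomorphisms -/

section Relations

variable {A : Type*} [AddCommGroup A] {p : ℕ} [hp : Fact p.Prime] {σ τ : AddMonoid.End A}

omit hp in
/-- `σ^i τ σ^i = τ` from `σ τ σ = τ`. [folklore] -/
theorem pow_mul_mul_pow_eq_of_dihedral (hστ : σ * τ * σ = τ) (i : ℕ) : σ ^ i * τ * σ ^ i = τ := by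
  induction i with
  | zero => rw [pow_zero, one_mul, mul_one]
  | succ i ih =>
    have h1 : σ ^ (i + 1) = σ * σ ^ i := pow_succ' σ i
    have h2 : σ ^ (i + 1) = σ ^ i * σ := pow_succ σ i
    calc σ ^ (i + 1) * τ * σ ^ (i + 1) = (σ * σ ^ i) * τ * (σ ^ i * σ) := by rw [← h1, ← h2]
      _ = σ * (σ ^ i * τ * σ ^ i) * σ := by simp only [mul_assoc]
      _ = τ := by rw [ih, hστ]

omit hp in
/-- `σ^i τ = τ σ^(p-i)` for `i ≤ p`, from `σ^p = 1` and `σ τ σ = τ`. [folklore] -/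
theorem pow_mul_eq_mul_pow_sub_of_dihedral (hσ : σ ^ p = 1) (hστ : σ * τ * σ = τ) {i : ℕ}
    (hi : i ≤ p) : σ ^ i * τ = τ * σ ^ (p - i) := by
  have h1 : σ ^ i * σ ^ (p - i) = 1 := by rw [← pow_add, Nat.add_sub_cancel' hi, hσ]
  calc σ ^ i * τ = σ ^ i * τ * (σ ^ i * σ ^ (p - i)) := by rw [h1, mul_one]
    _ = σ ^ i * τ * σ ^ i * σ ^ (p - i) := (mul_assoc _ _ _).symm
    _ = τ * σ ^ (p - i) := by rw [pow_mul_mul_pow_eq_of_dihedral hστ]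

/-- `σ τ = τ σ^(p-1)`. [folklore] -/
theorem mul_eq_mul_pow_of_dihedral (hσ : σ ^ p = 1) (hστ : σ * τ * σ = τ) :
    σ * τ = τ * σ ^ (p - 1) := by
  have h := pow_mul_eq_mul_pow_sub_of_dihedral hσ hστ (i := 1) hp.out.one_lt.le
  rwa [pow_one] at h

/-- `σ^(p-1) τ = τ σ`. [folklore] -/
theorem pow_sub_one_mul_eq_of_dihedral (hσ : σ ^ p = 1) (hστ : σ * τ * σ = τ) :
    σ ^ (p - 1) * τ = τ * σ := by
  have h := pow_mul_eq_mul_pow_sub_of_dihedral hσ hστ (i := p - 1) (Nat.sub_le p 1)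
  rwa [show p - (p - 1) = 1 by have := hp.out.one_lt; omega, pow_one] at h

/-- **`θ = σ - σ^(p-1)` anticommutes with `τ`**: `τ θ = -θ τ`. [folklore] -/
theorem mul_sub_pow_eq_neg_of_dihedral (hσ : σ ^ p = 1) (hστ : σ * τ * σ = τ) :
    τ * (σ - σ ^ (p - 1)) = -((σ - σ ^ (p - 1)) * τ) := by
  rw [mul_sub, sub_mul, ← pow_sub_one_mul_eq_of_dihedral hσ hστ, ← mul_eq_mul_pow_of_dihedral hσ hστ,
    neg_sub]

omit hp in
/-- `N_σ τ = τ N_σ` (`N_σ = 1 + σ + ⋯ + σ^(p-1)`; reindex `i ↦ p - i`). [folklore] -/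
theorem normEnd_mul_eq_mul_normEnd_of_dihedral (hσ : σ ^ p = 1) (hστ : σ * τ * σ = τ) :
    normEnd σ p * τ = τ * normEnd σ p := by
  calc normEnd σ p * τ = ∑ i ∈ Finset.range p, σ ^ i * τ := Finset.sum_mul _ _ _
    _ = ∑ i ∈ Finset.range p, τ * σ ^ (p - i) :=
        Finset.sum_congr rfl fun i hi ↦
          pow_mul_eq_mul_pow_sub_of_dihedral hσ hστ (Finset.mem_range.mp hi).le
    _ = τ * ∑ i ∈ Finset.range p, σ ^ (p - i) := (Finset.mul_sum _ _ _).symm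
    _ = τ * (normEnd σ p * σ) := by
        congr 1
        unfold normEnd
        rw [Finset.sum_mul, ← Finset.sum_range_reflect (fun i ↦ σ ^ i * σ) p]
        refine Finset.sum_congr rfl fun i hi ↦ ?_
        have hi' := Finset.mem_range.mp hi
        show σ ^ (p - i) = σ ^ (p - 1 - i) * σ
        rw [← pow_succ]
        congr 1
        omega
    _ = τ * normEnd σ p := by rw [normEnd_mul hσ]

/-- `τ` preserves `A^σ`. [folklore] -/
theorem apply_mem_fixedSub_of_dihedral (hστ : σ * τ * σ = τ) {x : A} (hx : x ∈ fixedSub σ) :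
    τ x ∈ fixedSub σ := by
  rw [mem_fixedSub_iff] at hx ⊢
  conv_lhs => rw [← hx]
  change (σ * τ * σ) x = τ x
  rw [hστ]

omit hp in
/-- `τ` preserves `ker N_σ`. [folklore] -/
theorem apply_mem_kerNorm_of_dihedral (hσ : σ ^ p = 1) (hστ : σ * τ * σ = τ) {x : A}
    (hx : x ∈ kerNorm σ p) : τ x ∈ kerNorm σ p := by
  rw [mem_kerNorm_iff] at hx ⊢
  change (normEnd σ p * τ) x = 0
  rw [normEnd_mul_eq_mul_normEnd_of_dihedral hσ hστ, AddMonoid.End.coe_mul, comp_apply, hx,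
    map_zero]

/-- `x ∈ fixedSub (-τ) ↔ τ x = -x` (the `-1`-eigenspace of `τ`). [folklore] -/
theorem mem_fixedSub_neg_iff (x : A) : x ∈ fixedSub (-τ) ↔ τ x = -x := by
  rw [mem_fixedSub_iff]
  change -(τ x) = x ↔ _
  rw [neg_eq_iff_eq_neg]

/-- `y + τ y` is `τ`-fixed when `τ² = 1`. [folklore] -/
theorem add_apply_mem_fixedSub (hτ : τ ^ 2 = 1) (y : A) : y + τ y ∈ fixedSub τ := by
  rw [mem_fixedSub_iff, map_add, ← comp_apply (f := ⇑τ) (g := ⇑τ), ← AddMonoid.End.coe_mul,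
    ← pow_two, hτ, add_comm]
  rfl

/-- `y - τ y` is in the `-1`-eigenspace when `τ² = 1`. [folklore] -/
theorem sub_apply_mem_fixedSub_neg (hτ : τ ^ 2 = 1) (y : A) : y - τ y ∈ fixedSub (-τ) := by
  rw [mem_fixedSub_neg_iff, map_sub, ← comp_apply (f := ⇑τ) (g := ⇑τ), ← AddMonoid.End.coe_mul,
    ← pow_two, hτ, neg_sub]
  rfl

end Relations

/-! ## On `B = ker N_σ`: `θ = σ - σ⁻¹` swaps the `τ`-eigenspaces up to quasi-isomorphism -/

section KerNormPart

variable {B : Type*} [AddCommGroup B] {p : ℕ} [hp : Fact p.Prime] {s t : AddMonoid.End B}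

omit hp in
/-- `1 + s + ⋯ + s^(p-1) = 0` implies `s^p = 1` (`(∑ sⁱ)(s - 1) = s^p - 1`). [folklore] -/
theorem pow_eq_one_of_sum_pow_eq_zero (hs : ∑ i ∈ Finset.range p, s ^ i = 0) : s ^ p = 1 := by
  have h := geom_sum_mul s p
  rw [hs, zero_mul] at h
  exact (sub_eq_zero.mp h.symm)

/-- **The kernel of `θ = s - s^(p-1)` is killed by `p`** (on `B` with `∑ sⁱ = 0`, `p` odd):
`θ x = 0` gives `s² x = x`, hence `s x = s^(p+1) x = x`, hence `p x = (∑ sⁱ) x = 0`. [folklore] -/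
theorem nsmul_eq_zero_of_sub_pow_apply_eq_zero (hs : ∑ i ∈ Finset.range p, s ^ i = 0)
    (hp2 : p ≠ 2) {x : B} (hθ : (s - s ^ (p - 1)) x = 0) : p • x = 0 := by
  have hsp : s ^ p = 1 := pow_eq_one_of_sum_pow_eq_zero hs
  obtain ⟨m, hm⟩ := hp.out.odd_of_ne_two hp2
  have h1 : s x = (s ^ (p - 1)) x := by
    rwa [addMonoidEnd_sub_apply, sub_eq_zero] at hθ
  have h2 : (s ^ 2) x = x := by
    rw [pow_two, AddMonoid.End.coe_mul, comp_apply, h1, ← comp_apply (f := ⇑s),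
      ← AddMonoid.End.coe_mul, ← pow_succ', show p - 1 + 1 = p by omega, hsp]
    rfl
  have h3 : ∀ k : ℕ, (s ^ (2 * k)) x = x := fun k ↦ by
    induction k with
    | zero => rw [mul_zero, pow_zero]; rfl
    | succ k ih => rw [Nat.mul_succ, pow_add, AddMonoid.End.coe_mul, comp_apply, h2, ih]
  have h4 : s x = x := by
    have h := h3 (m + 1)
    rwa [show 2 * (m + 1) = p + 1 by omega, pow_succ, hsp, one_mul] at h
  exact nsmul_eq_zero_of_mem_ker_sub_one hs (b := x)
    (by rw [AddMonoidHom.mem_ker]; change s x - x = 0; rw [h4, sub_self])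

/-- **The image of `θ = s - s^(p-1)` contains `2p·B`** (on a `p`-primary `B` with `∑ sⁱ = 0`,
`p` odd): `p y = (s - 1) c₁` (`nsmul_mem_range_sub_one`), `2 = (1 + s)·∑(-s)ⁱ`, and
`(1 + s)(s - 1) = θ s`, all polynomials in `s` commuting with each other; so
`2p y = θ (s ∑(-s)ⁱ c₁)`. [folklore] -/
theorem exists_sub_pow_apply_eq_nsmul (hs : ∑ i ∈ Finset.range p, s ^ i = 0) (hp2 : p ≠ 2)
    (hB : ∀ b : B, ∃ n : ℕ, p ^ n • b = 0) (y : B) :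
    ∃ c : B, (s - s ^ (p - 1)) c = (2 * p) • y := by
  have hsp : s ^ p = 1 := pow_eq_one_of_sum_pow_eq_zero hs
  have hodd : Odd p := hp.out.odd_of_ne_two hp2
  obtain ⟨c₁, hc₁⟩ := nsmul_mem_range_sub_one hs hB y
  set alt : AddMonoid.End B := ∑ i ∈ Finset.range p, (-s) ^ i with halt
  -- `(1 + s) alt = 2`
  have h2 : (1 + s) * alt = 2 := by
    have h := mul_neg_geom_sum (-s) p
    rw [sub_neg_eq_add, hodd.neg_pow, hsp, sub_neg_eq_add, one_add_one_eq_two] at h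
    exact h
  -- `alt` commutes with `s - 1`
  have hcomm : alt * (s - 1) = (s - 1) * alt := by
    have ha : alt = aeval s (∑ i ∈ Finset.range p, (-X : ℤ[X]) ^ i) := by
      rw [halt, map_sum]; simp only [map_pow, map_neg, aeval_X]
    have hb : s - 1 = aeval s (X - 1 : ℤ[X]) := by rw [map_sub, aeval_X, map_one]
    rw [ha, hb]
    exact aeval_mul_comm s _ _
  -- `(1 + s)(s - 1) = θ s`
  have hθ : (1 + s) * (s - 1) = (s - s ^ (p - 1)) * s := by
    rw [add_mul, one_mul, mul_sub, mul_one, sub_mul, ← pow_succ,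
      show p - 1 + 1 = p by have := hp.out.one_lt; omega, hsp]
    abel
  have hc₁' : (s - 1) c₁ = p • y := hc₁
  have hop : (s - s ^ (p - 1)) * s * alt = 2 * (s - 1) := by
    rw [← hθ, mul_assoc, ← hcomm, ← mul_assoc, h2]
  refine ⟨s (alt c₁), ?_⟩
  calc (s - s ^ (p - 1)) (s (alt c₁)) = ((s - s ^ (p - 1)) * s * alt) c₁ := rfl
    _ = ((2 : AddMonoid.End B) * (s - 1)) c₁ := by rw [hop]
    _ = (2 * p) • y := by
        rw [AddMonoid.End.coe_mul, comp_apply, hc₁',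
          show (2 : AddMonoid.End B) = ((2 : ℕ) : AddMonoid.End B) from rfl,
          AddMonoid.End.natCast_apply, smul_smul]

/-- `θ = s - s^(p-1)` maps the `+1`-eigenspace of `t` to the `-1`-eigenspace (`t θ = -θ t`).
[folklore] -/
theorem sub_pow_apply_mem_fixedSub_neg (hsp : s ^ p = 1) (hst : s * t * s = t) {x : B}
    (hx : x ∈ fixedSub t) : (s - s ^ (p - 1)) x ∈ fixedSub (-t) := by
  rw [mem_fixedSub_iff] at hx
  rw [mem_fixedSub_neg_iff]
  change (t * (s - s ^ (p - 1))) x = _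
  rw [mul_sub_pow_eq_neg_of_dihedral hsp hst, addMonoidEnd_neg_apply, AddMonoid.End.coe_mul,
    comp_apply, hx]

/-- `θ = s - s^(p-1)` maps the `-1`-eigenspace of `t` to the `+1`-eigenspace. [folklore] -/
theorem sub_pow_apply_mem_fixedSub (hsp : s ^ p = 1) (hst : s * t * s = t) {x : B}
    (hx : x ∈ fixedSub (-t)) : (s - s ^ (p - 1)) x ∈ fixedSub t := by
  rw [mem_fixedSub_neg_iff] at hx
  rw [mem_fixedSub_iff]
  change (t * (s - s ^ (p - 1))) x = _
  rw [mul_sub_pow_eq_neg_of_dihedral hsp hst, addMonoidEnd_neg_apply, AddMonoid.End.coe_mul,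
    comp_apply, hx, map_neg, neg_neg]

/-- **`corank B^t = corank B^{-t}`** on a `p`-primary `B` with finite `B[p]`, `∑ sⁱ = 0`,
`t² = 1`, `s t s = t`, `p` odd: `θ = s - s^(p-1)` restricts to `B^t → B^{-t}` with kernel killed
by `p` (`nsmul_eq_zero_of_sub_pow_apply_eq_zero`) and cokernel killed by `4p` (for `t y = -y`
and `θ c = 2p y`: `θ (c + t c) = θ c - t θ c = 4p y` with `c + t c ∈ B^t`), and the corank is a
quasi-isomorphism invariant (`zpCorank_eq_of_nsmul_ker_of_nsmul_coker`). (Over `ℚ_p`: the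
semilinear involution `t` of the `ℚ_p(ζ_p)`-space `B ⊗ ℚ_p` has `±1`-eigenspaces swapped by
`ζ - ζ⁻¹`.) [cite: DokchitserDokchitserAnnals2010, §4.6, p. 26 (`rk_p(E/L) = m_1 + (p-1)/2·m_ρ`)] -/
theorem zpCorank_fixedSub_eq_zpCorank_fixedSub_neg (hs : ∑ i ∈ Finset.range p, s ^ i = 0)
    (ht : t ^ 2 = 1) (hst : s * t * s = t) (hp2 : p ≠ 2)
    (hB : ∀ b : B, ∃ n : ℕ, p ^ n • b = 0) [Finite B[(p : ℤ)]] :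
    zpCorank (fixedSub t) p = zpCorank (fixedSub (-t)) p := by
  have hsp : s ^ p = 1 := pow_eq_one_of_sum_pow_eq_zero hs
  obtain ⟨hP, hPfin⟩ := primary_and_finite_torsionBy_of_injective (i := (fixedSub t).subtype)
    Subtype.val_injective hB
  obtain ⟨hM, hMfin⟩ := primary_and_finite_torsionBy_of_injective (i := (fixedSub (-t)).subtype)
    Subtype.val_injective hB
  haveI := hPfin
  haveI := hMfin
  set θ : AddMonoid.End B := s - s ^ (p - 1) with hθdef
  set f : fixedSub t →+ fixedSub (-t) :=
    ((endHom θ).comp (fixedSub t).subtype).codRestrict (fixedSub (-t))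
      fun x ↦ sub_pow_apply_mem_fixedSub_neg hsp hst x.2 with hfdef
  have hf : ∀ x : fixedSub t, ((f x : fixedSub (-t)) : B) = θ x := fun x ↦ rfl
  have hN : 4 * p ≠ 0 := Nat.mul_ne_zero (by norm_num) hp.out.ne_zero
  refine zpCorank_eq_of_nsmul_ker_of_nsmul_coker f hP hM hN (fun x hx ↦ ?_) (fun y ↦ ?_)
  · -- kernel killed by `p`, hence by `4p`
    have hx' : θ x = 0 := by
      rw [← hf x, hx]; rfl
    apply Subtype.ext
    rw [AddSubgroupClass.coe_nsmul, ZeroMemClass.coe_zero, mul_smul,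
      nsmul_eq_zero_of_sub_pow_apply_eq_zero hs hp2 hx', smul_zero]
  · -- cokernel killed by `4p`
    have hy : t y = -(y : B) := (mem_fixedSub_neg_iff (y : B)).mp y.2
    obtain ⟨c, hc⟩ := exists_sub_pow_apply_eq_nsmul hs hp2 hB (y : B)
    refine ⟨⟨c + t c, add_apply_mem_fixedSub ht c⟩, Subtype.ext ?_⟩
    rw [hf, AddSubgroupClass.coe_nsmul]
    change θ (c + t c) = (4 * p) • (y : B)
    have htθ : t (θ c) = -(θ (t c)) := by
      change (t * θ) c = -((θ * t) c)
      rw [hθdef, mul_sub_pow_eq_neg_of_dihedral hsp hst, addMonoidEnd_neg_apply]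
    have hθt : θ (t c) = -(t (θ c)) := by rw [htθ, neg_neg]
    rw [map_add, hθt, hc, map_nsmul, hy, smul_neg, neg_neg, ← add_nsmul,
      show 2 * p + 2 * p = 4 * p by ring]

/-- **`corank B = corank B^t + corank B^{-t}`** for an endomorphism `t` with `t² = 1` of a
`p`-primary `B` with finite `B[p]`: `B^t × B^{-t} → B`, `(u, v) ↦ u + v`, has kernel and cokernel
killed by `2` (`2b = (b + t b) + (b - t b)`). [folklore] -/
theorem zpCorank_eq_zpCorank_fixedSub_add_zpCorank_fixedSub_neg (ht : t ^ 2 = 1)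
    (hB : ∀ b : B, ∃ n : ℕ, p ^ n • b = 0) [Finite B[(p : ℤ)]] :
    zpCorank B p = zpCorank (fixedSub t) p + zpCorank (fixedSub (-t)) p := by
  obtain ⟨hP, hPfin⟩ := primary_and_finite_torsionBy_of_injective (i := (fixedSub t).subtype)
    Subtype.val_injective hB
  obtain ⟨hM, hMfin⟩ := primary_and_finite_torsionBy_of_injective (i := (fixedSub (-t)).subtype)
    Subtype.val_injective hB
  haveI := hPfin
  haveI := hMfin
  have hi : Injective (AddMonoidHom.inl (fixedSub t) (fixedSub (-t))) := fun a b h ↦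
    (Prod.ext_iff.mp h).1
  have hex : ∀ x : (fixedSub t) × (fixedSub (-t)), AddMonoidHom.snd _ _ x = 0 →
      x ∈ (AddMonoidHom.inl (fixedSub t) (fixedSub (-t))).range :=
    fun x hx ↦ ⟨x.1, Prod.ext rfl (by simpa using hx.symm)⟩
  have hfi : ∀ a : fixedSub t, AddMonoidHom.snd _ (fixedSub (-t)) (AddMonoidHom.inl _ _ a) = 0 :=
    fun _ ↦ rfl
  obtain ⟨hPM, hPMfin⟩ := primary_and_finite_torsionBy_of_shortExact hi hex hfi hP hM
  haveI := hPMfin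
  set g : (fixedSub t) × (fixedSub (-t)) →+ B :=
    AddMonoidHom.coprod (fixedSub t).subtype (fixedSub (-t)).subtype with hgdef
  have h1 : zpCorank ((fixedSub t) × (fixedSub (-t))) p = zpCorank B p := by
    refine zpCorank_eq_of_nsmul_ker_of_nsmul_coker g hPM hB two_ne_zero (fun x hx ↦ ?_)
      (fun b ↦ ?_)
    · obtain ⟨u, v⟩ := x
      change (u : B) + v = 0 at hx
      have hu : t u = (u : B) := (mem_fixedSub_iff t (u : B)).mp u.2
      have hv : t v = -(v : B) := (mem_fixedSub_neg_iff (v : B)).mp v.2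
      have huv : (u : B) = -v := eq_neg_of_add_eq_zero_left hx
      have htu : t u = -(u : B) := by rw [huv, map_neg, hv]
      have h2u : 2 • (u : B) = 0 := by
        rw [two_nsmul]
        nth_rewrite 2 [← hu]
        rw [htu, add_neg_cancel]
      have h2v : 2 • (v : B) = 0 := by
        rw [show (v : B) = -u by rw [huv, neg_neg], smul_neg, h2u, neg_zero]
      refine Prod.ext (Subtype.ext ?_) (Subtype.ext ?_)
      · rw [Prod.smul_fst, AddSubgroupClass.coe_nsmul, h2u]; rfl
      · rw [Prod.smul_snd, AddSubgroupClass.coe_nsmul, h2v]; rfl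
    · refine ⟨(⟨b + t b, add_apply_mem_fixedSub ht b⟩, ⟨b - t b, sub_apply_mem_fixedSub_neg ht b⟩),
        ?_⟩
      change (b + t b) + (b - t b) = 2 • b
      rw [two_nsmul]
      abel
  rw [← h1, zpCorank_prod hP hM]

/-- **On `B` with `∑ sⁱ = 0`, `t² = 1`, `s t s = t` (`p` odd): `corank B = (p - 1) k` and
`corank B^t = (p - 1)/2 · k`** for one and the same `k` — the number of copies of `ρ`
(`exists_zpCorank_eq_mul_of_sum_pow_eq_zero`, `zpCorank_eq_zpCorank_fixedSub_add_zpCorank_fixedSub_neg`,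
`zpCorank_fixedSub_eq_zpCorank_fixedSub_neg`).
[cite: DokchitserDokchitserAnnals2010, §4.6, p. 26 (`rk_p(E/L) = m_1 + (p-1)/2·m_ρ`)] -/
theorem exists_zpCorank_eq_and_zpCorank_fixedSub_eq_of_sum_pow_eq_zero
    (hs : ∑ i ∈ Finset.range p, s ^ i = 0) (ht : t ^ 2 = 1) (hst : s * t * s = t) (hp2 : p ≠ 2)
    (hB : ∀ b : B, ∃ n : ℕ, p ^ n • b = 0) [Finite B[(p : ℤ)]] :
    ∃ k : ℕ, zpCorank B p = (p - 1) * k ∧ zpCorank (fixedSub t) p = (p - 1) / 2 * k := by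
  obtain ⟨k, hk⟩ := exists_zpCorank_eq_mul_of_sum_pow_eq_zero hs hB
  have h1 := zpCorank_eq_zpCorank_fixedSub_add_zpCorank_fixedSub_neg (p := p) ht hB
  have h2 := zpCorank_fixedSub_eq_zpCorank_fixedSub_neg hs ht hst hp2 hB
  obtain ⟨m, hm⟩ := hp.out.odd_of_ne_two hp2
  refine ⟨k, hk, ?_⟩
  have h3 : 2 * zpCorank (fixedSub t) p = 2 * (m * k) :=
    calc 2 * zpCorank (fixedSub t) p = zpCorank (fixedSub t) p + zpCorank (fixedSub (-t)) p := by
          rw [two_mul, h2]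
      _ = zpCorank B p := h1.symm
      _ = (p - 1) * k := hk
      _ = 2 * (m * k) := by rw [← mul_assoc]; congr 1; omega
  rw [Nat.eq_of_mul_eq_mul_left (by norm_num : 0 < 2) h3]
  congr 1
  omega

end KerNormPart

/-! ## The dihedral pair `(σ, τ)` on `A`: `corank A = corank A^σ + (p-1)k`, `corank A^τ = corank A^H + (p-1)/2·k` -/

section Dihedral

variable {A : Type*} [AddCommGroup A] {p : ℕ} [hp : Fact p.Prime] {σ τ : AddMonoid.End A}

/-- **`corank A^τ = corank (A^σ ∩ A^τ) + corank (ker N_σ ∩ A^τ)`**: the quasi-isomorphism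
`A^σ × ker N_σ → A` is `τ`-equivariant (`τ` preserves `A^σ` and `ker N_σ`), and on `τ`-fixed
points `(A^σ)^τ × (ker N_σ)^τ → A^τ` has kernel killed by `p` and cokernel killed by `2p`
(`2p x = (N x + τ N x) + ((p x - N x) + τ (p x - N x))` for `τ x = x`). [folklore] -/
theorem zpCorank_fixedSub_eq_add_of_dihedral (hσ : σ ^ p = 1) (hτ : τ ^ 2 = 1)
    (hστ : σ * τ * σ = τ) (hA : ∀ a : A, ∃ n : ℕ, p ^ n • a = 0) [Finite A[(p : ℤ)]] :
    zpCorank (fixedSub τ) p =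
      zpCorank ↥(fixedSub σ ⊓ fixedSub τ) p + zpCorank ↥(kerNorm σ p ⊓ fixedSub τ) p := by
  obtain ⟨hT, hTfin⟩ := primary_and_finite_torsionBy_of_injective (i := (fixedSub τ).subtype)
    Subtype.val_injective hA
  obtain ⟨hF, hFfin⟩ := primary_and_finite_torsionBy_of_injective
    (i := (fixedSub σ ⊓ fixedSub τ).subtype) Subtype.val_injective hA
  obtain ⟨hK, hKfin⟩ := primary_and_finite_torsionBy_of_injective
    (i := (kerNorm σ p ⊓ fixedSub τ).subtype) Subtype.val_injective hA
  haveI := hTfin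
  haveI := hFfin
  haveI := hKfin
  have hi : Injective (AddMonoidHom.inl ↥(fixedSub σ ⊓ fixedSub τ) ↥(kerNorm σ p ⊓ fixedSub τ)) :=
    fun a b h ↦ (Prod.ext_iff.mp h).1
  have hex : ∀ x : ↥(fixedSub σ ⊓ fixedSub τ) × ↥(kerNorm σ p ⊓ fixedSub τ),
      AddMonoidHom.snd _ _ x = 0 →
        x ∈ (AddMonoidHom.inl ↥(fixedSub σ ⊓ fixedSub τ) ↥(kerNorm σ p ⊓ fixedSub τ)).range :=
    fun x hx ↦ ⟨x.1, Prod.ext rfl (by simpa using hx.symm)⟩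
  have hfi : ∀ a : ↥(fixedSub σ ⊓ fixedSub τ),
      AddMonoidHom.snd _ ↥(kerNorm σ p ⊓ fixedSub τ) (AddMonoidHom.inl _ _ a) = 0 := fun _ ↦ rfl
  obtain ⟨hFK, hFKfin⟩ := primary_and_finite_torsionBy_of_shortExact hi hex hfi hF hK
  haveI := hFKfin
  set g : ↥(fixedSub σ ⊓ fixedSub τ) × ↥(kerNorm σ p ⊓ fixedSub τ) →+ fixedSub τ :=
    AddMonoidHom.coprod (AddSubgroup.inclusion inf_le_right) (AddSubgroup.inclusion inf_le_right)
    with hgdef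
  have hN : 2 * p ≠ 0 := Nat.mul_ne_zero two_ne_zero hp.out.ne_zero
  have h1 : zpCorank (↥(fixedSub σ ⊓ fixedSub τ) × ↥(kerNorm σ p ⊓ fixedSub τ)) p =
      zpCorank (fixedSub τ) p := by
    refine zpCorank_eq_of_nsmul_ker_of_nsmul_coker g hFK hT hN (fun x hx ↦ ?_) (fun y ↦ ?_)
    · obtain ⟨a, b⟩ := x
      have hab : (a : A) + b = 0 := congrArg Subtype.val hx
      have h := nsmul_eq_zero_of_fixedKerMap_eq_zero (σ := σ) (p := p)
        (⟨(a : A), (AddSubgroup.mem_inf.mp a.2).1⟩, ⟨(b : A), (AddSubgroup.mem_inf.mp b.2).1⟩) hab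
      have ha : p • (a : A) = 0 := by
        have h' := congrArg (fun z : fixedSub σ × kerNorm σ p ↦ ((z.1 : fixedSub σ) : A)) h
        simpa only [Prod.smul_fst, AddSubgroupClass.coe_nsmul, Prod.fst_zero,
          ZeroMemClass.coe_zero] using h'
      have hb : p • (b : A) = 0 := by
        have h' := congrArg (fun z : fixedSub σ × kerNorm σ p ↦ ((z.2 : kerNorm σ p) : A)) h
        simpa only [Prod.smul_snd, AddSubgroupClass.coe_nsmul, Prod.snd_zero,
          ZeroMemClass.coe_zero] using h'
      refine Prod.ext (Subtype.ext ?_) (Subtype.ext ?_)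
      · rw [Prod.smul_fst, AddSubgroupClass.coe_nsmul, mul_smul, ha, smul_zero]; rfl
      · rw [Prod.smul_snd, AddSubgroupClass.coe_nsmul, mul_smul, hb, smul_zero]; rfl
    · have hy : τ y = (y : A) := (mem_fixedSub_iff τ (y : A)).mp y.2
      have hn1 : normEnd σ p (y : A) ∈ fixedSub σ := normEnd_apply_mem_fixedSub hσ (y : A)
      have hn2 : τ (normEnd σ p (y : A)) ∈ fixedSub σ := apply_mem_fixedSub_of_dihedral hστ hn1
      have hm1 : p • (y : A) - normEnd σ p (y : A) ∈ kerNorm σ p :=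
        nsmul_sub_normEnd_apply_mem_kerNorm hσ (y : A)
      have hm2 : τ (p • (y : A) - normEnd σ p (y : A)) ∈ kerNorm σ p :=
        apply_mem_kerNorm_of_dihedral hσ hστ hm1
      refine ⟨(⟨normEnd σ p (y : A) + τ (normEnd σ p (y : A)),
          ⟨add_mem hn1 hn2, add_apply_mem_fixedSub hτ _⟩⟩,
        ⟨(p • (y : A) - normEnd σ p (y : A)) + τ (p • (y : A) - normEnd σ p (y : A)),
          ⟨add_mem hm1 hm2, add_apply_mem_fixedSub hτ _⟩⟩), Subtype.ext ?_⟩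
      change (normEnd σ p (y : A) + τ (normEnd σ p (y : A))) +
          ((p • (y : A) - normEnd σ p (y : A)) + τ (p • (y : A) - normEnd σ p (y : A))) =
        (((2 * p) • y : fixedSub τ) : A)
      rw [AddSubgroupClass.coe_nsmul, map_sub, map_nsmul, hy, mul_smul, two_nsmul]
      abel
  rw [← h1, zpCorank_prod hF hK]

/-- **`D_{2p}`-coranks.** Let `A` be a `p`-primary abelian group with finite `A[p]` (`p` an odd
prime) and `σ`, `τ` endomorphisms with `σ^p = 1`, `τ² = 1`, `σ τ σ = τ` — an action of the
dihedral group `D_{2p} = ⟨σ, τ⟩`. Then there is a natural number `k` with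
`corank A = corank A^σ + (p - 1)·k` and `corank A^τ = corank A^{σ,τ} + (p - 1)/2 · k`.
This is "`X ≅ 1^{⊕m_1} ⊕ ε^{⊕m_ε} ⊕ ρ^{⊕m_ρ}` [...] `rk_p(E/K) = m_1`, `rk_p(E/M) = m_1 + m_ε`,
`rk_p(E/L) = m_1 + (p-1)/2 · m_ρ`" (and `rk_p(E/F) = m_1 + m_ε + (p - 1) m_ρ`) of
Dokchitser–Dokchitser 2010, §4.6 (p. 26), for `X^∨ = A = Sel_{p^∞}(E/F)`, `Gal(F/K) = ⟨σ, τ⟩ ≅ D_{2p}`,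
`M = F^σ`, `L = F^τ`, with `k = m_ρ`; in particular Prop. 4.17's
`2/(p-1)·(rk_p(E/L) - rk_p(E/K))` equals the `m_ρ` defined by `rk_p(E/F) = rk_p(E/M) + (p-1) m_ρ`.
Proof: `corank A = corank A^σ + corank B`, `B = ker N_σ`
(`zpCorank_eq_zpCorank_fixedSub_add_zpCorank_kerNorm`); `corank A^τ = corank A^{σ,τ} + corank B^τ`
(`zpCorank_fixedSub_eq_add_of_dihedral`); and on `B`, `corank B = (p-1) k`, `corank B^τ = (p-1)k/2`
(`exists_zpCorank_eq_and_zpCorank_fixedSub_eq_of_sum_pow_eq_zero` for the restrictions of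
`σ`, `τ`). [cite: DokchitserDokchitserAnnals2010, §4.6, proof of Thm. 4.19 (p. 26); §4.5, Prop. 4.17] -/
theorem exists_zpCorank_eq_and_zpCorank_fixedSub_eq_of_dihedral (hσ : σ ^ p = 1) (hτ : τ ^ 2 = 1)
    (hστ : σ * τ * σ = τ) (hp2 : p ≠ 2) (hA : ∀ a : A, ∃ n : ℕ, p ^ n • a = 0)
    [Finite A[(p : ℤ)]] :
    ∃ k : ℕ, zpCorank A p = zpCorank (fixedSub σ) p + (p - 1) * k ∧
      zpCorank (fixedSub τ) p = zpCorank ↥(fixedSub σ ⊓ fixedSub τ) p + (p - 1) / 2 * k := by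
  obtain ⟨hB, hBfin⟩ := primary_and_finite_torsionBy_of_injective (i := (kerNorm σ p).subtype)
    Subtype.val_injective hA
  obtain ⟨hK, hKfin⟩ := primary_and_finite_torsionBy_of_injective
    (i := (kerNorm σ p ⊓ fixedSub τ).subtype) Subtype.val_injective hA
  haveI := hBfin
  haveI := hKfin
  -- the restrictions `s`, `t` of `σ`, `τ` to `B = ker N_σ`
  set s : AddMonoid.End (kerNorm σ p) := restrictKerNorm hσ with hsdef
  set t : AddMonoid.End (kerNorm σ p) :=
    ((endHom τ).comp (kerNorm σ p).subtype).codRestrict (kerNorm σ p)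
      (fun x ↦ apply_mem_kerNorm_of_dihedral hσ hστ x.2) with htdef
  have ht_coe : ∀ x : kerNorm σ p, ((t x : kerNorm σ p) : A) = τ x := fun x ↦ rfl
  have hs : ∑ i ∈ Finset.range p, s ^ i = 0 := sum_pow_restrictKerNorm_eq_zero hσ
  have ht2 : t ^ 2 = 1 := by
    refine DFunLike.ext _ _ fun x ↦ Subtype.ext ?_
    rw [coe_pow_apply_of_coe_apply τ t ht_coe 2 x, hτ]
    rfl
  have hst : s * t * s = t := by
    refine DFunLike.ext _ _ fun x ↦ Subtype.ext ?_
    change (σ * τ * σ) (x : A) = τ x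
    rw [hστ]
  obtain ⟨hP, hPfin⟩ := primary_and_finite_torsionBy_of_injective (i := (fixedSub t).subtype)
    Subtype.val_injective hB
  haveI := hPfin
  obtain ⟨k, hk, hkt⟩ :=
    exists_zpCorank_eq_and_zpCorank_fixedSub_eq_of_sum_pow_eq_zero hs ht2 hst hp2 hB
  -- `B^t ≅ ker N_σ ∩ A^τ`
  have hiso : zpCorank (fixedSub t) p = zpCorank ↥(kerNorm σ p ⊓ fixedSub τ) p := by
    set e : fixedSub t →+ ↥(kerNorm σ p ⊓ fixedSub τ) :=
      ((kerNorm σ p).subtype.comp (fixedSub t).subtype).codRestrict (kerNorm σ p ⊓ fixedSub τ)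
        (fun x ↦ ⟨x.1.2, (mem_fixedSub_iff τ _).mpr
          ((ht_coe x.1).symm.trans (congrArg Subtype.val ((mem_fixedSub_iff t x.1).mp x.2)))⟩)
      with hedef
    refine zpCorank_eq_of_nsmul_ker_of_nsmul_coker e hP hK one_ne_zero (fun x hx ↦ ?_)
      (fun y ↦ ⟨⟨⟨(y : A), (AddSubgroup.mem_inf.mp y.2).1⟩, (mem_fixedSub_iff t _).mpr
        (Subtype.ext ((mem_fixedSub_iff τ (y : A)).mp (AddSubgroup.mem_inf.mp y.2).2))⟩, ?_⟩)
    · have h : ((x : kerNorm σ p) : A) = 0 := congrArg Subtype.val hx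
      rw [one_smul]
      exact Subtype.ext (Subtype.ext h)
    · rw [one_smul]
      rfl
  refine ⟨k, ?_, ?_⟩
  · rw [zpCorank_eq_zpCorank_fixedSub_add_zpCorank_kerNorm hσ hA, hk]
  · rw [zpCorank_fixedSub_eq_add_of_dihedral hσ hτ hστ hA, ← hiso, hkt]

/-- **Parity form.** Under the same hypotheses, `corank A^τ - corank A^{σ,τ} = (p-1)/2 · k` and
`corank A - corank A^σ = (p - 1)·k` with the same `k`; in particular
`2·(corank A^τ - corank A^{σ,τ}) = corank A - corank A^σ`, i.e.
`2 (rk_p(E/L) - rk_p(E/K)) = rk_p(E/F) - rk_p(E/M)` for `Gal(F/K) ≅ D_{2p}`.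
[cite: DokchitserDokchitserAnnals2010, §4.6, proof of Thm. 4.19 (p. 26)] -/
theorem two_mul_zpCorank_fixedSub_add_eq_of_dihedral (hσ : σ ^ p = 1) (hτ : τ ^ 2 = 1)
    (hστ : σ * τ * σ = τ) (hp2 : p ≠ 2) (hA : ∀ a : A, ∃ n : ℕ, p ^ n • a = 0)
    [Finite A[(p : ℤ)]] :
    2 * zpCorank (fixedSub τ) p + zpCorank (fixedSub σ) p =
      2 * zpCorank ↥(fixedSub σ ⊓ fixedSub τ) p + zpCorank A p := by
  obtain ⟨k, hk, hkt⟩ := exists_zpCorank_eq_and_zpCorank_fixedSub_eq_of_dihedral hσ hτ hστ hp2 hA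
  obtain ⟨m, hm⟩ := hp.out.odd_of_ne_two hp2
  rw [hk, hkt, show (p - 1) / 2 = m by omega, show p - 1 = 2 * m by omega]
  ring

end Dihedral

end Literature.NumberTheory.EllipticCurves

end
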